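import Summits.Ventures.CertifiedManyBodySolver.Downfold.BoxesNdNiO2FillingLadder
import HarnessLib

/-!
# The TOP of the NdNiO₂ parent (M21) filling row: located parent-column fillings (`0.94`, `0.944`), the fact «nothing printed lies in
# (0.944, 0.954]», and the n-CUTS `213/250 | 9/10 | 91/100 | 477/500` of the M21 `n` face used by the coverage plan

Venture CertifiedManyBodySolver, cell `pub/hubbard-downfold` (MO-S1, D-0154 (1)(C) COVERAGE material (iii) NdNiO₂); namespace
`Summit.Ventures.CertifiedManyBodySolver.Downfold`. Seat hubbard-cov-ndnio2-unc-3 (`prover-hubbard-cov-ndnio2-unc-3-0`), lane «filling / doping-column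
ladder» (lead RULING R-ma 2026-08-28T05:18:00Z); second file of the lane after `Downfold/BoxesNdNiO2FillingLadder.lean` (p607538) and
`Downfold/BoxesNdNiO2DopingChain.lean` (p607578), kept separate for the 400-line rule. INPUTS: cov-ndnio2-lit-1's CROSS-READ OF RECORD (HOME INBOX
2026-08-28T05:44:24Z: two printed parent-column fillings not yet typed — Kitatani et al. npj QM 5 59 (2020) arXiv:2002.12230 p.3 L24 «undoped NdNiO₂
n_{d_{x²−y²}} = 0.944 ≈ 0.95» (DMFT/DΓA occupation object) and Sakakibara et al. PRL 125 077003 (2020) arXiv:1909.00060 p.2 L86-92 «n_{Ni d_{x²−y²}} = 0.94 …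
about 0.06 holes … self-doped from the La electron pockets» (seven-orbital GGA, La for Nd) — both re-read by this seat at the cited lines) and
cov-ndnio2-plan-1's NDNIO2-COVERAGE-PLAN v0.1 (kinematic cover ⇒ residual `n`-face `[91/100, 477/500]`; today's zero-row cut at `9/10` from
hubbard-tc p1's leaf `ndBoxE_parent_stiffnessSeqLeaf`, `0.4736879 < 0.4779578`).

* §1 `ndNiO2Fill_n_dmft_x0_lit = 118/125`, `laNiO2Fill_n_7orb_lit = 47/50` (LOCATED CONTEXT, not admitted): both inside `ndNiO2E_M21_n`, margins `1/100`,
  `7/500` from the top; the seven-orbital self-doping `3/50` is below the dsd member hull `[8/125, 13/100]` by `1/250` yet inside the floored row;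
  `ndNiO2Fill_if_7orb_admitted_arith`: IF admitted as a member the hull-then-floor rows would become dsd `[9/200, 29/200]`, `n [171/200, 191/200]` —
  top `0.955 > 0.954` by `1/1000` (a re-issue), numbers for the lead; `ndNiO2Fill_parent_readings_le`: every printed / located parent filling is
  `≤ 0.944`, the top slice `(0.944, 0.954]` (width `1/100`) is floor-only territory;
* §2 the n-cuts `ndNiO2Fill_nCut_lo/mid/hi = [213/250, 9/10] / [9/10, 91/100] / [91/100, 477/500]` as sub-entries of `ndNiO2E_M21_n`, their widths,
  containments, and the trichotomy `ndNiO2Fill_nCuts_cover` (every point of the row lies in one cut) — the real-line fact under the box-level doors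
  `Box.holdsOn_of_split` / `Box.holdsOn_of_quarter` of `Downfold/ParameterBoxBisection.lean` (coordinate `.filling`, entry `ndNiO2E_M21_n`, `hc := rfl`),
  which the cover closer (cov-ndnio2-box-2's pen) instantiates.

Everything here is PROVED (definitions with bodies; no `sorry`). HONEST FRAMING: typed SCREENING-GRADE rows, located literature numbers [float] and
kernel-checked arithmetic between them; typing certifies nothing about NdNiO₂; no hull, row, word or box of record is edited or re-issued (the lead's
pen); no summit statement is proved by this file.
-/

noncomputable section

namespace Summit.Ventures.CertifiedManyBodySolver.Downfold

open Set NonemptyInterval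

/-- Membership of a RATIONAL in a printed interval `[lo, hi]` is decided on `ℚ` (local helper). [folklore] -/
private theorem ndFillTop_mem_ofEnds_rat {lo hi : ℚ} {h : lo ≤ hi} {g : Grade} {q : ℚ} (h₁ : lo ≤ q) (h₂ : q ≤ hi) :
    (Entry.ofEnds lo hi h g).Mem ((q : ℚ) : ℝ) := by
  rw [Entry.mem_ofEnds_iff]
  exact ⟨by exact_mod_cast h₁, by exact_mod_cast h₂⟩

/-- A rational OUTSIDE `[lo, hi]` on the left is not a member (local helper). [folklore] -/
private theorem ndFillTop_not_mem_ofEnds_of_gt {lo hi : ℚ} {h : lo ≤ hi} {g : Grade} {q : ℚ} (hq : q < lo) :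
    ¬ (Entry.ofEnds lo hi h g).Mem ((q : ℚ) : ℝ) := by
  rw [Entry.mem_ofEnds_iff]
  rintro ⟨h₁, -⟩
  exact absurd (by exact_mod_cast h₁ : lo ≤ q) (not_le.2 hq)

/-! ## §1 Located parent-column fillings near the TOP of the M21 row; «nothing printed lies in (0.944, 0.954]» -/

/-- LOCATED CONTEXT member (DMFT/DΓA occupation object; NOT admitted — the lead ruled the DMFT object CONTEXT for M22, §OF-RECORD v1): undoped NdNiO₂
`n_{d_{x²−y²}} = 0.944 ≈ 0.95` (Kitatani et al. npj QM 5 59 (2020), arXiv:2002.12230 p.3 L24) [float]. [folklore] -/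
def ndNiO2Fill_n_dmft_x0_lit : ℚ := 118 / 125
/-- LOCATED CONTEXT member (seven-orbital GGA occupation object, La for Nd; NOT admitted): `n_{Ni d_{x²−y²}} = 0.94`, «about 0.06 holes per unit cell
… self-doped from the La electron pockets» (Sakakibara et al. PRL 125 077003 (2020), arXiv:1909.00060 p.2 L86-92) [float]. [folklore] -/
def laNiO2Fill_n_7orb_lit : ℚ := 47 / 50

/-- Both located parent fillings sit INSIDE the typed M21 row `[213/250, 477/500]`, at margins `1/100` (`0.944`) and `7/500` (`0.94`) from its TOP
end; the seven-orbital self-doping `3/50` lies BELOW the x = 0 dsd member hull `[8/125, 13/100]` by `1/250` yet INSIDE the floored row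
`[47/1000, 147/1000]` (so, as context, nothing moves). [folklore] -/
theorem ndNiO2Fill_parent_context_members :
    ndNiO2E_M21_n.Mem ((ndNiO2Fill_n_dmft_x0_lit : ℚ) : ℝ) ∧ ndNiO2E_M21_n.Mem ((laNiO2Fill_n_7orb_lit : ℚ) : ℝ) ∧
      (477 / 500 : ℚ) - ndNiO2Fill_n_dmft_x0_lit = 1 / 100 ∧ (477 / 500 : ℚ) - laNiO2Fill_n_7orb_lit = 7 / 500 ∧
      ¬ ndNiO2Fill_dsdHull_x0.Mem (((3 / 50 : ℚ)) : ℝ) ∧ ndNiO2Fill_dsdRow_x0.Mem (((3 / 50 : ℚ)) : ℝ) ∧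
      ndNiO2Fill_dsd_pocket_p0 - 3 / 50 = 1 / 250 := by
  refine ⟨ndFillTop_mem_ofEnds_rat (by norm_num [ndNiO2Fill_n_dmft_x0_lit]) (by norm_num [ndNiO2Fill_n_dmft_x0_lit]),
    ndFillTop_mem_ofEnds_rat (by norm_num [laNiO2Fill_n_7orb_lit]) (by norm_num [laNiO2Fill_n_7orb_lit]),
    by norm_num [ndNiO2Fill_n_dmft_x0_lit], by norm_num [laNiO2Fill_n_7orb_lit],
    ndFillTop_not_mem_ofEnds_of_gt (by norm_num), ndFillTop_mem_ofEnds_rat (by norm_num) (by norm_num),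
    by norm_num [ndNiO2Fill_dsd_pocket_p0]⟩

/-- **IF the lead ADMITTED the seven-orbital self-doping `3/50` as a dsd MEMBER (it is context today), the hull-then-floor construction would
re-issue the rows**: hull `[3/50, 13/100]` (half-width `7/200 < 1/20`) ⇒ row `midpoint 19/200 ± 1/20 = [9/200, 29/200]` ⇒ `n ∈ [171/200, 191/200]
= [0.855, 0.955]`, whose TOP `0.955` exceeds the typed M21 end `477/500` by `1/1000` (an OUTWARD move = a re-issue by the version rule) while the
bottom moves INWARD by `3/1000`. Numbers for the lead's admission ruling; nothing is re-issued here. [folklore] -/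
theorem ndNiO2Fill_if_7orb_admitted_arith :
    ((3 / 50 : ℚ) + 13 / 100) / 2 = 19 / 200 ∧ ((13 / 100 : ℚ) - 3 / 50) / 2 < 1 / 20 ∧
      (19 / 200 : ℚ) - 1 / 20 = 9 / 200 ∧ (19 / 200 : ℚ) + 1 / 20 = 29 / 200 ∧
      1 - (29 / 200 : ℚ) = 171 / 200 ∧ 1 - (9 / 200 : ℚ) = 191 / 200 ∧
      (477 / 500 : ℚ) < 191 / 200 ∧ (191 / 200 : ℚ) - 477 / 500 = 1 / 1000 ∧ (171 / 200 : ℚ) - 213 / 250 = 3 / 1000 := by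
  norm_num

/-- **«NOTHING PRINTED LIES IN (0.944, 0.954]»**: every printed or located parent-column (x = 0) filling reading — orbital `87/100`, ARPES-class
`91/100`, band count `116/125`, reservoir `117/125`, seven-orbital `47/50`, DMFT `118/125` — is at most `118/125 = 0.944 < 477/500`; the top slice
`(118/125, 477/500]` of the M21 row (width `1/100`) is INFL-4f-FLOOR territory only. Against the coverage plan's residual `n`-face
`[91/100, 477/500]` (cov-ndnio2-plan-1 v0.1): four of the six readings lie in it (`0.928, 0.936, 0.94, 0.944`), two below it (`0.87`, and the
ARPES-class `0.91` AT its lower end). [folklore] -/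
theorem ndNiO2Fill_parent_readings_le :
    (87 / 100 : ℚ) ≤ 118 / 125 ∧ (91 / 100 : ℚ) ≤ 118 / 125 ∧ 1 - ndNiO2Fill_dsd_bandCount ≤ 118 / 125 ∧
      1 - ndNiO2Fill_dsd_pocket_p0 ≤ 118 / 125 ∧ laNiO2Fill_n_7orb_lit ≤ 118 / 125 ∧ ndNiO2Fill_n_dmft_x0_lit = 118 / 125 ∧
      (118 / 125 : ℚ) < 477 / 500 ∧ (477 / 500 : ℚ) - 118 / 125 = 1 / 100 ∧
      ((91 / 100 : ℚ) ≤ 1 - ndNiO2Fill_dsd_bandCount ∧ (91 / 100 : ℚ) ≤ 1 - ndNiO2Fill_dsd_pocket_p0 ∧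
        (91 / 100 : ℚ) ≤ laNiO2Fill_n_7orb_lit ∧ (87 / 100 : ℚ) < 91 / 100) := by
  norm_num [ndNiO2Fill_dsd_bandCount, ndNiO2Fill_dsd_pocket_p0, laNiO2Fill_n_7orb_lit, ndNiO2Fill_n_dmft_x0_lit]

/-! ## §2 The n-CUTS of the M21 `n` face (coverage plan v0.1) -/

/-- **The n-CUTS of the M21 `n` face used by the coverage plan**, as sub-entries of `ndNiO2E_M21_n = [213/250, 477/500]`: `[213/250, 9/10]`
(worded below the bar TODAY by hubbard-tc p1's kernel leaf `ndBoxE_parent_stiffnessSeqLeaf`, `t′ ∈ [−23/50, −9/25]`, `n ≤ 9/10`, constant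
`0.4736879 < 0.4779578`), `[9/10, 91/100]` (the KINCOVER row at `n_top = 91/100`, cov-ndnio2-box-2's pen) and `[91/100, 477/500]` (the residual's
`n`-face, the certified solve). [folklore] -/
def ndNiO2Fill_nCut_lo : Entry := Entry.ofEnds (213 / 250) (9 / 10) (by norm_num) .screening
/-- n-cut sub-entry `[9/10, 91/100]` (width `1/100`). [folklore] -/
def ndNiO2Fill_nCut_mid : Entry := Entry.ofEnds (9 / 10) (91 / 100) (by norm_num) .screening
/-- n-cut sub-entry `[91/100, 477/500]` — the residual's `n`-face (width `11/250 = 0.044`). [folklore] -/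
def ndNiO2Fill_nCut_hi : Entry := Entry.ofEnds (91 / 100) (477 / 500) (by norm_num) .screening

/-- Each n-cut sub-entry is enclosed by the M21 row; the cuts are ordered and tile it (`213/250 ≤ 9/10 ≤ 91/100 ≤ 477/500`); widths `6/125`,
`1/100`, `11/250` (`48 % / 10 % / 43 %` of the row). [folklore] -/
theorem ndNiO2Fill_nCuts_sub :
    (∀ x : ℝ, ndNiO2Fill_nCut_lo.Mem x → ndNiO2E_M21_n.Mem x) ∧ (∀ x : ℝ, ndNiO2Fill_nCut_mid.Mem x → ndNiO2E_M21_n.Mem x) ∧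
      (∀ x : ℝ, ndNiO2Fill_nCut_hi.Mem x → ndNiO2E_M21_n.Mem x) ∧
      ((213 / 250 : ℚ) ≤ 9 / 10 ∧ (9 / 10 : ℚ) ≤ 91 / 100 ∧ (91 / 100 : ℚ) ≤ 477 / 500) ∧
      ((9 / 10 : ℚ) - 213 / 250 = 6 / 125 ∧ (91 / 100 : ℚ) - 9 / 10 = 1 / 100 ∧ (477 / 500 : ℚ) - 91 / 100 = 11 / 250) := by
  refine ⟨fun x hx => Entry.mem_ofEnds_mono (by norm_num) (by norm_num) hx,
    fun x hx => Entry.mem_ofEnds_mono (by norm_num) (by norm_num) hx,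
    fun x hx => Entry.mem_ofEnds_mono (by norm_num) (by norm_num) hx, by norm_num, by norm_num⟩

/-- **Every point of the M21 row lies in one of the three n-cuts** (the real-line trichotomy a cover door uses; the box-level doors are
`Downfold/ParameterBoxBisection`'s `Box.holdsOn_of_split` / `Box.holdsOn_of_quarter`, coordinate `.filling`, entry `ndNiO2E_M21_n`, `hc := rfl`).
[folklore] -/
theorem ndNiO2Fill_nCuts_cover {x : ℝ} (hx : ndNiO2E_M21_n.Mem x) :
    ndNiO2Fill_nCut_lo.Mem x ∨ ndNiO2Fill_nCut_mid.Mem x ∨ ndNiO2Fill_nCut_hi.Mem x := by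
  rw [ndNiO2E_M21_n, Entry.mem_ofEnds_iff] at hx
  simp only [ndNiO2Fill_nCut_lo, ndNiO2Fill_nCut_mid, ndNiO2Fill_nCut_hi, Entry.mem_ofEnds_iff]
  push_cast at hx ⊢
  rcases le_total x (9 / 10) with h1 | h1
  · exact Or.inl ⟨hx.1, h1⟩
  · rcases le_total x (91 / 100) with h2 | h2
    · exact Or.inr (Or.inl ⟨h1, h2⟩)
    · exact Or.inr (Or.inr ⟨h2, hx.2⟩)

/-! ## §3 (append, same seat) lead RULING R-mg (g)(3), 2026-08-28T06:12:05Z: the seven-orbital self-doping `3/50` is ADMITTED as an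
orbital-occupation-object dsd MEMBER (Nomura-class, La-proxy tag) — member hull v2 `[3/50, 13/100]`; the ROW OF RECORD `[47/1000, 147/1000]` is
UNCHANGED by the floor reading of record (R-mb (c): «entry ⊇ member hull» ∧ «entry half-width ≥ FLOOR»); the re-centred `[9/200, 29/200]` of §1 stays a
documented alternative, not of record; the ARPES counts of §1 of the first file stay CONTEXT (R-mg (g)(1)) -/

/-- **x = 0 dsd MEMBER SET v2** (after R-mg (g)(3)): the four §DFT-1b members `8/125, 17/250, 9/125, 13/100` and the admitted seven-orbital member
`3/50` (Sakakibara et al. 2020, arXiv:1909.00060 p.2 L86-92 [float]; `laNiO2Fill_n_7orb_lit = 1 − 3/50`). VERSION RULE: new def; §1 of the first file untouched. [folklore] -/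
def ndNiO2Fill_dsd_members_v2 : List ℚ :=
  [ndNiO2Fill_dsd_pocket_p0, ndNiO2Fill_dsd_pocket_sto, ndNiO2Fill_dsd_bandCount, ndNiO2Fill_dsd_orbital_lit, 1 - laNiO2Fill_n_7orb_lit]

/-- **x = 0 dsd MEMBER HULL v2 = `[3/50, 13/100]`** (lower END = the admitted seven-orbital member `3/50`, upper END = Nomura 2019 `13/100`). NOT the
row of record (that is `ndNiO2Fill_dsdRow_x0`, unchanged). [folklore] -/
def ndNiO2Fill_dsdHull_x0_v2 : Entry := Entry.ofEnds (3 / 50) (13 / 100) (by norm_num) .screening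

/-- The v2 member list, evaluated: `[8/125, 17/250, 9/125, 13/100, 3/50]`; its minimum is the new member `3/50` and its maximum `13/100` (NAMED ENDS
of the v2 hull). [folklore] -/
theorem ndNiO2Fill_dsd_members_v2_eq :
    ndNiO2Fill_dsd_members_v2 = [8 / 125, 17 / 250, 9 / 125, 13 / 100, 3 / 50] ∧
      (∀ m ∈ ndNiO2Fill_dsd_members_v2, (3 / 50 : ℚ) ≤ m ∧ m ≤ 13 / 100) ∧
      (3 / 50 : ℚ) ∈ ndNiO2Fill_dsd_members_v2 ∧ (13 / 100 : ℚ) ∈ ndNiO2Fill_dsd_members_v2 := by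
  have h : ndNiO2Fill_dsd_members_v2 = [8 / 125, 17 / 250, 9 / 125, 13 / 100, 3 / 50] := by
    norm_num [ndNiO2Fill_dsd_members_v2, ndNiO2Fill_dsd_pocket_p0, ndNiO2Fill_dsd_pocket_sto, ndNiO2Fill_dsd_bandCount,
      ndNiO2Fill_dsd_orbital_lit, laNiO2Fill_n_7orb_lit]
  refine ⟨h, ?_, ?_, ?_⟩
  · rw [h]; intro m hm; simp only [List.mem_cons, List.mem_nil_iff, or_false] at hm
    rcases hm with rfl | rfl | rfl | rfl | rfl <;> norm_num
  · rw [h]; simp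
  · rw [h]; simp

/-- Every v2 member lies in the v2 hull (as reals). [folklore] -/
theorem ndNiO2Fill_dsdHull_x0_v2_members (m : ℚ) (hm : m ∈ ndNiO2Fill_dsd_members_v2) : ndNiO2Fill_dsdHull_x0_v2.Mem ((m : ℚ) : ℝ) := by
  obtain ⟨h₁, h₂⟩ := ndNiO2Fill_dsd_members_v2_eq.2.1 m hm
  exact ndFillTop_mem_ofEnds_rat h₁ h₂

/-- **v1 hull ⊆ v2 hull** (the admission moved the member hull's lower end OUTWARD `8/125 → 3/50`, by `1/250`). [folklore] -/
theorem ndNiO2Fill_dsdHull_x0_v2_of_v1 {x : ℝ} (hx : ndNiO2Fill_dsdHull_x0.Mem x) : ndNiO2Fill_dsdHull_x0_v2.Mem x :=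
  Entry.mem_ofEnds_mono (by norm_num) (by norm_num) hx

/-- **THE ROW OF RECORD IS UNCHANGED (R-mg (g)(3) in the R-mb (c) reading, typed): `row ⊇ hull v2` ∧ `row half-width 1/20 ≥ class floor 1/20 ≥
FLOOR(dsd) 3/100`**; the v2 hull's own half-width is `7/200 < 1/20` (so the floor still governs); consequently `n (x = 0) = [213/250, 477/500]` stands and
every v2 member words an `n = 1 − dsd` inside `ndNiO2E_M21_n` (the new member gives `47/50`). [folklore] -/
theorem ndNiO2Fill_dsdRow_x0_floorRung_v2 :
    (∀ x : ℝ, ndNiO2Fill_dsdHull_x0_v2.Mem x → ndNiO2Fill_dsdRow_x0.Mem x) ∧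
      (ndNiO2Fill_dsdRow_x0.encl.snd - ndNiO2Fill_dsdRow_x0.encl.fst) / 2 = 1 / 20 ∧ (3 / 100 : ℚ) ≤ 1 / 20 ∧
      (ndNiO2Fill_dsdHull_x0_v2.encl.snd - ndNiO2Fill_dsdHull_x0_v2.encl.fst) / 2 = 7 / 200 ∧ (7 / 200 : ℚ) < 1 / 20 ∧
      (∀ m ∈ ndNiO2Fill_dsd_members_v2, ndNiO2E_M21_n.Mem (((1 - m : ℚ)) : ℝ)) := by
  refine ⟨fun x hx => Entry.mem_ofEnds_mono (by norm_num) (by norm_num) hx, ?_, by norm_num, ?_, by norm_num, ?_⟩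
  · simp only [ndNiO2Fill_dsdRow_x0, Entry.encl_ofEnds_fst, Entry.encl_ofEnds_snd]; norm_num
  · simp only [ndNiO2Fill_dsdHull_x0_v2, Entry.encl_ofEnds_fst, Entry.encl_ofEnds_snd]; norm_num
  · intro m hm
    obtain ⟨h₁, h₂⟩ := ndNiO2Fill_dsd_members_v2_eq.2.1 m hm
    exact ndFillTop_mem_ofEnds_rat (by linarith) (by linarith)

/-! ## §4 (append, seat hubbard-cov-ndnio2-unc-3 g1) lead RULING R-mp (b), 2026-08-28T07:54:04Z: the Li…Feng–Peng 2026 (arXiv:2607.16684) Fig. 3d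
α-band Luttinger-volume count of the [Li25] NdNiO₂ PRL parent films is ADMITTED as a LOCATED MEMBER of the M21 `n` row — «p_α = 0.090 ± 0.025 ⇒ n_α = 0.910
[0.884, 0.935]», flags FIGURE-READ (vector-exact: hubbard-downfold-lit-2 REFVALS-2 v4.36 §79 / LI2026-FIG3D-READOUT.md ed0597ee55f5ff61 — `p_α = 0.0899` from the
e-print's page stream, tick-fit residual 9e-5; «±» = the authors' drawn bar, meaning unstated) + VIA-SECONDARY (same group quantifying its 2025 primary; text «about
9 % holes»; the PRL SM Fig. S4 number, acq-13772, remains unheld — when held it becomes the PRIMARY member and this read stays beside it as TAG); AGAINST THE ROW: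
INTERIOR ⇒ no edge / word / record consequence (R-mb (c) reading; d⁹-plane member rule R-mm (i)–(v), print precision 3 decimals). The first NdNiO₂-SPECIFIC located
count beside the La-host CLASS count `laNiO2Fill_dsd_arpes_lit = 9/100` of §1 of the first file (Ding 2024; R-mg (g)(1): context) — same central value. CONTEXT ONLY
(never members, R-mp (b)): PrNiO₂ `0.090`, Pr₀.₉₅Ca₀.₀₅NiO₂ `0.140`, and Fig. 4a's constructed `p = x + 0.0898` scale. VERSION RULE: new defs; §1–§3 untouched. -/

/-- LOCATED MEMBER — the figure read itself [float, FIGURE-READ vector-exact]: `p_α = 0.0899` (Li…Feng–Peng 2026, arXiv:2607.16684, Fig. 3d, NdNiO₂ marker;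
hubbard-downfold-lit-2 REFVALS-2 v4.36 §79, LI2026-FIG3D-READOUT.md ed0597ee55f5ff61). [folklore] -/
def ndNiO2Fill_pAlpha_arpes_read : ℚ := 899 / 10000
/-- LOCATED MEMBER AS ADMITTED (lead R-mp (b); print precision 3 decimals): `p_α = 0.090` holes in the Ni `3d_{x²−y²}` (α) band of the parent film, from the
Luttinger volume [float]. [folklore] -/
def ndNiO2Fill_pAlpha_arpes : ℚ := 9 / 100
/-- The authors' drawn half-bar `± 0.025` on `p_α` [float; meaning unstated, R-mp (b)]. [folklore] -/
def ndNiO2Fill_pAlpha_arpes_halfBar : ℚ := 1 / 40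
/-- The member's central filling `n_α = 1 − p_α = 0.910` [float]. [folklore] -/
def ndNiO2Fill_nAlpha_arpes : ℚ := 91 / 100
/-- **The member's printed `n` bar `[0.884, 0.935]` AS RULED** (R-mp (b)) — a located-member sub-interval INSIDE the M21 `n` row; NOT a row, NOT a `Refines`
sub-box, NOT a hull end (the row of record stays `ndNiO2E_M21_n = [213/250, 477/500]`, the x = 0 dsd member hull stays `[3/50, 13/100]`). [folklore] -/
def ndNiO2Fill_nAlpha_arpes_bar : Entry := Entry.ofEnds (221 / 250) (187 / 200) (by norm_num) .screening
/-- **x = 0 dsd MEMBER SET v3** = v2 (`8/125, 17/250, 9/125, 13/100, 3/50`) with the admitted ARPES α-band count `9/100` appended. VERSION RULE: new def. [folklore] -/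
def ndNiO2Fill_dsd_members_v3 : List ℚ := ndNiO2Fill_dsd_members_v2 ++ [ndNiO2Fill_pAlpha_arpes]

/-- **Arithmetic of the admitted member** (kernel-checked): `n_α = 1 − 9/100 = 91/100`; the `p` bar `9/100 ∓ 1/40 = [13/200, 23/200]` (`= [0.065, 0.115]`) ⇒ the
central-based `n` bar `[177/200, 187/200] = [0.885, 0.935]`; from the READ `0.0899`: `n ∈ [8851/10000, 9351/10000]`; the RULED print `[221/250, 187/200] = [0.884, 0.935]`
contains the lower ends of both (`0.884 ≤ 0.885 ≤ 0.8851`) and equals the central-based top, the read-based top exceeding it by `1/10000` (inside the 3-decimal print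
precision of R-mm (v)); `|read − print| = 1/10000` on `p_α`; the NdNiO₂-specific count EQUALS the La-host class count `laNiO2Fill_dsd_arpes_lit` (`9/100`, Ding 2024)
and `n_α = 1 − laNiO2Fill_dsd_arpes_lit`. [folklore] -/
theorem ndNiO2Fill_arpes_member_arith :
    1 - ndNiO2Fill_pAlpha_arpes = ndNiO2Fill_nAlpha_arpes ∧
      ndNiO2Fill_pAlpha_arpes - ndNiO2Fill_pAlpha_arpes_halfBar = 13 / 200 ∧ ndNiO2Fill_pAlpha_arpes + ndNiO2Fill_pAlpha_arpes_halfBar = 23 / 200 ∧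
      (1 - (23 / 200 : ℚ) = 177 / 200 ∧ 1 - (13 / 200 : ℚ) = 187 / 200) ∧
      (1 - (ndNiO2Fill_pAlpha_arpes_read + ndNiO2Fill_pAlpha_arpes_halfBar) = 8851 / 10000 ∧
        1 - (ndNiO2Fill_pAlpha_arpes_read - ndNiO2Fill_pAlpha_arpes_halfBar) = 9351 / 10000) ∧
      ((221 / 250 : ℚ) ≤ 177 / 200 ∧ (177 / 200 : ℚ) ≤ 8851 / 10000 ∧ (9351 / 10000 : ℚ) - 187 / 200 = 1 / 10000) ∧
      |ndNiO2Fill_pAlpha_arpes_read - ndNiO2Fill_pAlpha_arpes| = 1 / 10000 ∧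
      (ndNiO2Fill_pAlpha_arpes = laNiO2Fill_dsd_arpes_lit ∧ ndNiO2Fill_nAlpha_arpes = 1 - laNiO2Fill_dsd_arpes_lit) := by
  norm_num [ndNiO2Fill_pAlpha_arpes, ndNiO2Fill_nAlpha_arpes, ndNiO2Fill_pAlpha_arpes_halfBar, ndNiO2Fill_pAlpha_arpes_read, laNiO2Fill_dsd_arpes_lit]

/-- **INTERIOR (typed R-mp (b) «AGAINST THE ROW»)**: the ruled bar `[221/250, 187/200]` lies INSIDE the M21 `n` row `[213/250, 477/500]` with clearances `4/125 = 0.032`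
(bottom) and `19/1000 = 0.019` (top); the central `91/100` is a member of the row, `7/1000` above the row's midpoint `903/1000`; both ends and the centre are row members.
[folklore] -/
theorem ndNiO2Fill_nAlpha_arpes_bar_interior :
    (∀ x : ℝ, ndNiO2Fill_nAlpha_arpes_bar.Mem x → ndNiO2E_M21_n.Mem x) ∧
      ((221 / 250 : ℚ) - 213 / 250 = 4 / 125 ∧ (477 / 500 : ℚ) - 187 / 200 = 19 / 1000) ∧
      ndNiO2E_M21_n.Mem ((ndNiO2Fill_nAlpha_arpes : ℚ) : ℝ) ∧
      (ndNiO2Fill_nAlpha_arpes - ((213 / 250 : ℚ) + 477 / 500) / 2 = 7 / 1000) ∧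
      (ndNiO2E_M21_n.Mem (((221 / 250 : ℚ)) : ℝ) ∧ ndNiO2E_M21_n.Mem (((187 / 200 : ℚ)) : ℝ)) := by
  refine ⟨fun x hx => Entry.mem_ofEnds_mono (by norm_num) (by norm_num) hx, by norm_num,
    ndFillTop_mem_ofEnds_rat (by norm_num [ndNiO2Fill_nAlpha_arpes]) (by norm_num [ndNiO2Fill_nAlpha_arpes]),
    by norm_num [ndNiO2Fill_nAlpha_arpes], ndFillTop_mem_ofEnds_rat (by norm_num) (by norm_num), ndFillTop_mem_ofEnds_rat (by norm_num) (by norm_num)⟩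

/-- **The `p` bar is INTERIOR to the dsd member hulls too**: `13/200, 9/100, 23/200` all lie in the v1 hull `[8/125, 13/100]` (margins `1/1000` at the bottom,
`3/200` at the top), hence in the v2 hull `[3/50, 13/100]` and in the floored row of record `[47/1000, 147/1000]` — «dsd-equivalent 0.090 ∈ [0.047, 0.147] INTERIOR»
(lit-2 §79). [folklore] -/
theorem ndNiO2Fill_pAlpha_arpes_bar_in_hulls :
    (ndNiO2Fill_dsdHull_x0.Mem (((13 / 200 : ℚ)) : ℝ) ∧ ndNiO2Fill_dsdHull_x0.Mem ((ndNiO2Fill_pAlpha_arpes : ℚ) : ℝ) ∧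
        ndNiO2Fill_dsdHull_x0.Mem (((23 / 200 : ℚ)) : ℝ)) ∧
      (ndNiO2Fill_dsdHull_x0_v2.Mem (((13 / 200 : ℚ)) : ℝ) ∧ ndNiO2Fill_dsdHull_x0_v2.Mem ((ndNiO2Fill_pAlpha_arpes : ℚ) : ℝ) ∧
        ndNiO2Fill_dsdHull_x0_v2.Mem (((23 / 200 : ℚ)) : ℝ)) ∧
      (ndNiO2Fill_dsdRow_x0.Mem (((13 / 200 : ℚ)) : ℝ) ∧ ndNiO2Fill_dsdRow_x0.Mem (((23 / 200 : ℚ)) : ℝ)) ∧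
      ((13 / 200 : ℚ) - 8 / 125 = 1 / 1000 ∧ (13 / 100 : ℚ) - 23 / 200 = 3 / 200) := by
  refine ⟨⟨ndFillTop_mem_ofEnds_rat (by norm_num) (by norm_num),
      ndFillTop_mem_ofEnds_rat (by norm_num [ndNiO2Fill_pAlpha_arpes]) (by norm_num [ndNiO2Fill_pAlpha_arpes]),
      ndFillTop_mem_ofEnds_rat (by norm_num) (by norm_num)⟩,
    ⟨ndFillTop_mem_ofEnds_rat (by norm_num) (by norm_num),
      ndFillTop_mem_ofEnds_rat (by norm_num [ndNiO2Fill_pAlpha_arpes]) (by norm_num [ndNiO2Fill_pAlpha_arpes]),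
      ndFillTop_mem_ofEnds_rat (by norm_num) (by norm_num)⟩,
    ⟨ndFillTop_mem_ofEnds_rat (by norm_num) (by norm_num), ndFillTop_mem_ofEnds_rat (by norm_num) (by norm_num)⟩, by norm_num⟩

/-- **NO HULL / ROW CONSEQUENCE, typed**: the v3 member list evaluates to `[8/125, 17/250, 9/125, 13/100, 3/50, 9/100]`; every v3 member lies in `[3/50, 13/100]` and
both NAMED ENDS `3/50`, `13/100` are still members ⇒ the member hull is UNCHANGED (`ndNiO2Fill_dsdHull_x0_v2` is also the v3 hull) ⇒ by `ndNiO2Fill_dsdRow_x0_floorRung_v2`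
the row of record `[47/1000, 147/1000]` and `n (x = 0) = [213/250, 477/500]` stand (R-mb (c) reading: row ⊇ hull ∧ row half-width `1/20` ≥ FLOOR); every v3 member words an
`n = 1 − dsd` inside `ndNiO2E_M21_n` (the new one: `91/100`). [folklore] -/
theorem ndNiO2Fill_dsd_members_v3_noConsequence :
    ndNiO2Fill_dsd_members_v3 = [8 / 125, 17 / 250, 9 / 125, 13 / 100, 3 / 50, 9 / 100] ∧
      (∀ m ∈ ndNiO2Fill_dsd_members_v3, (3 / 50 : ℚ) ≤ m ∧ m ≤ 13 / 100) ∧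
      ((3 / 50 : ℚ) ∈ ndNiO2Fill_dsd_members_v3 ∧ (13 / 100 : ℚ) ∈ ndNiO2Fill_dsd_members_v3) ∧
      (∀ m ∈ ndNiO2Fill_dsd_members_v3, ndNiO2Fill_dsdHull_x0_v2.Mem ((m : ℚ) : ℝ)) ∧
      (∀ m ∈ ndNiO2Fill_dsd_members_v3, ndNiO2E_M21_n.Mem (((1 - m : ℚ)) : ℝ)) := by
  have h : ndNiO2Fill_dsd_members_v3 = [8 / 125, 17 / 250, 9 / 125, 13 / 100, 3 / 50, 9 / 100] := by
    rw [ndNiO2Fill_dsd_members_v3, ndNiO2Fill_dsd_members_v2_eq.1]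
    norm_num [ndNiO2Fill_pAlpha_arpes]
  have hb : ∀ m ∈ ndNiO2Fill_dsd_members_v3, (3 / 50 : ℚ) ≤ m ∧ m ≤ 13 / 100 := by
    rw [h]; intro m hm; simp only [List.mem_cons, List.mem_nil_iff, or_false] at hm
    rcases hm with rfl | rfl | rfl | rfl | rfl | rfl <;> norm_num
  refine ⟨h, hb, ⟨by rw [h]; simp, by rw [h]; simp⟩, fun m hm => ?_, fun m hm => ?_⟩
  · obtain ⟨h₁, h₂⟩ := hb m hm
    exact ndFillTop_mem_ofEnds_rat h₁ h₂
  · obtain ⟨h₁, h₂⟩ := hb m hm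
    exact ndFillTop_mem_ofEnds_rat (by linarith) (by linarith)

/-- **WHERE THE MEMBER'S BAR SITS against the coverage geometry** (numbers for the captain / box-2; nothing is re-cut): the bar `[0.884, 0.935]` meets all three n-cuts of §2
(`0.884 < 9/10 < 91/100 < 0.935`), its centre `91/100` IS the lower end of the residual's `n`-face `ndNiO2Fill_nCut_hi`; against the SOLVE-OWING density interval
R‴ = `[183/200, 477/500]` of the registered stubs (`stub_lowP/Q`, `stub_highP/Q`): the bar STRADDLES `183/200` (`0.884 < 0.915 < 0.935`), its part inside R‴ is `[183/200, 187/200]`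
(width `1/50`), the centre `0.910` lies in the node-free strip `[9/10, 183/200]` (kinematic leaf `ndnio2_M21_lowFillingCell183_below_bar`); and its TOP `0.935` is below the
seven-orbital `0.94` and the DMFT `0.944` — so `ndNiO2Fill_parent_readings_le` survives the admission: every located / printed parent filling is still `≤ 118/125`, the top
slice `(0.944, 0.954]` of the row (inside R‴) stays MEMBER-FREE floor territory. [folklore] -/
theorem ndNiO2Fill_nAlpha_arpes_bar_vs_cuts :
    ((221 / 250 : ℚ) < 9 / 10 ∧ (9 / 10 : ℚ) < 91 / 100 ∧ (91 / 100 : ℚ) < 187 / 200) ∧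
      ndNiO2Fill_nCut_hi.encl.fst = ndNiO2Fill_nAlpha_arpes ∧
      ((221 / 250 : ℚ) < 183 / 200 ∧ (183 / 200 : ℚ) < 187 / 200 ∧ (187 / 200 : ℚ) - 183 / 200 = 1 / 50 ∧ (187 / 200 : ℚ) < 477 / 500) ∧
      ((9 / 10 : ℚ) ≤ ndNiO2Fill_nAlpha_arpes ∧ ndNiO2Fill_nAlpha_arpes < 183 / 200) ∧
      ((187 / 200 : ℚ) < laNiO2Fill_n_7orb_lit ∧ laNiO2Fill_n_7orb_lit < ndNiO2Fill_n_dmft_x0_lit ∧ ndNiO2Fill_n_dmft_x0_lit = 118 / 125 ∧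
        (187 / 200 : ℚ) ≤ 118 / 125 ∧ (118 / 125 : ℚ) < 477 / 500) := by
  refine ⟨by norm_num, ?_, by norm_num, by norm_num [ndNiO2Fill_nAlpha_arpes], by
    norm_num [laNiO2Fill_n_7orb_lit, ndNiO2Fill_n_dmft_x0_lit]⟩
  simp only [ndNiO2Fill_nCut_hi, Entry.encl_ofEnds_fst, ndNiO2Fill_nAlpha_arpes]

end Summit.Ventures.CertifiedManyBodySolver.Downfold

end
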